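import Mathlib.Data.Nat.Choose.Lucas
import Mathlib.Data.Nat.Choose.Factorization
import Mathlib.Data.Nat.Factorization.Basic
import Mathlib.Tactic.Zify
import Mathlib.Tactic.Ring
import HarnessLib

/-!
# Lazard's comparison lemma, I: the binomial arithmetic (`d_n`, the coefficients of `C_n`, Lazard's index, block Lucas)
# ([Lazard 1955] Lemme 3 and §III, (3.1)–(3.3))

Topic `Literature/RingTheory/FormalGroups`; namespace `Literature.RingTheory.FormalGroups`.  THEOREMS about natural numbers
+ three auxiliary `ℕ`-valued definitions (`cocycleGcd`, `lazardCoeff`, `lazardIndex`); no named fact, no instance, no `sorry`.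
Sequel: `LazardComparisonLemmaNilpotent.lean` (the lemma itself over rings in which `p` is nilpotent).

A homogeneous polynomial `Γ(X,Y) = Σ_s a_s X^s Y^{n-s}` of degree `n ≥ 2` is a *symmetric 2-cocycle* when `Γ(X,Y) = Γ(Y,X)`
and `Γ(Y,Z) - Γ(X+Y,Z) + Γ(X,Y+Z) - Γ(X,Y) = 0`; on coefficients (Lazard 1955, §III, (3.5)–(3.6)): `a_0 = a_n = 0`,
`a_s = a_{n-s}`, and `C(s,i)·a_s = C(n-i,s-i)·a_i` for `1 ≤ i ≤ s ≤ n-1`.  LAZARD'S COMPARISON LEMMA (Lemme 3): the symmetric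
2-cocycles of degree `n` are the multiples of `C_n = d_n⁻¹((X+Y)^n - X^n - Y^n)`, `d_n = gcd_{0<s<n} C(n,s)` (`= ℓ` for
`n = ℓ^k` a prime power, `= 1` otherwise — Mathlib `Choose.gcd_choose_eq_minFac_of_isPrimePow`,
`Choose.gcd_choose_eq_one_of_not_isPrimePow`).  This file supplies the arithmetic of the proof:

* `cocycleGcd n = gcd_{1 ≤ s ≤ n-1} C(n,s)`, `lazardCoeff n s = C(n,s) / cocycleGcd n` (the coefficients `b_{n,s}` of `C_n`);
  `lazardCoeff_mul_cocycleGcd`, `lazardCoeff_symm`, `choose_mul_lazardCoeff` (the `b_{n,s}` satisfy the cocycle relations).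
* `choose_modEq_block` — Lucas' theorem in block form `C(p^a A + B, p^a C + D) ≡ C(A,C)·C(B,D) (mod p)` for `B, D < p^a`;
  `coprime_choose_prime_pow_of_digit_ne_zero` (`C(s,p^j) ≡ ⌊s/p^j⌋`), `coprime_choose_block_pred`.
* `lazardIndex p n` — Lazard's index `s₀` (`n/p` if `n` is a power of `p`, else `p^{v_p(n)}`): `one_le_lazardIndex`,
  `lazardIndex_le`, and **`not_dvd_lazardCoeff_lazardIndex`** (`p ∤ b_{n,s₀}`: Kummer `v_p C(p^e,p^{e-1}) = 1`, resp. Lucas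
  `C(p^e m, p^e) ≡ m`); `coprime_cocycleGcd` (`p ∤ d_n` unless `n` is a power of `p`).

## References
* [Lazard1955] M. Lazard, *Sur les groupes de Lie formels à un paramètre*, Bull. SMF 83 (1955), Lemme 3 (p. 257) and §III
  (pp. 261–264), (3.1)–(3.3).
* [Hazewinkel1978] M. Hazewinkel, *Formal Groups and Applications* (1978), §5.6 (the binomial coefficient arithmetic).
* [Fine1947] N. J. Fine, *Binomial coefficients modulo a prime*, Amer. Math. Monthly 54 (1947), Theorem 1 (Lucas).
-/

namespace Literature.RingTheory.FormalGroups

open Nat Finset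

/-! ## §1 The integers `d_n` and the coefficients of `C_n` -/

/-- `d_n = gcd { C(n,s) : 1 ≤ s ≤ n-1 }` — the content of `(X+Y)^n - X^n - Y^n`. [cite: Lazard1955, Lemme 3] -/
def cocycleGcd (n : ℕ) : ℕ := (Finset.Icc 1 (n - 1)).gcd n.choose

/-- The coefficients `b_{n,s} = C(n,s)/d_n` of Lazard's polynomial `C_n(X,Y) = d_n⁻¹((X+Y)^n - X^n - Y^n) = Σ b_{n,s} X^s Y^{n-s}`.
[cite: Lazard1955, Lemme 3] -/
def lazardCoeff (n s : ℕ) : ℕ := n.choose s / cocycleGcd n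

/-- `d_n ∣ C(n,s)` for `1 ≤ s ≤ n-1`. [cite: Lazard1955, Lemme 3] -/
theorem cocycleGcd_dvd_choose {n s : ℕ} (h1 : 1 ≤ s) (h2 : s ≤ n - 1) : cocycleGcd n ∣ n.choose s :=
  Finset.gcd_dvd (Finset.mem_Icc.mpr ⟨h1, h2⟩)

/-- `d_n ≠ 0` for `n ≥ 2` (as `C(n,1) = n ≠ 0`). [cite: Lazard1955, Lemme 3] -/
theorem cocycleGcd_ne_zero {n : ℕ} (hn : 2 ≤ n) : cocycleGcd n ≠ 0 := by
  intro h
  have h1 : cocycleGcd n ∣ n.choose 1 := cocycleGcd_dvd_choose le_rfl (by omega)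
  rw [h, zero_dvd_iff, Nat.choose_one_right] at h1
  omega

/-- `b_{n,s} · d_n = C(n,s)` for `1 ≤ s ≤ n-1`. [cite: Lazard1955, Lemme 3] -/
theorem lazardCoeff_mul_cocycleGcd {n s : ℕ} (h1 : 1 ≤ s) (h2 : s ≤ n - 1) :
    lazardCoeff n s * cocycleGcd n = n.choose s :=
  Nat.div_mul_cancel (cocycleGcd_dvd_choose h1 h2)

/-- Symmetry `b_{n,s} = b_{n,n-s}`. [cite: Lazard1955, Lemme 3] -/
theorem lazardCoeff_symm {n s : ℕ} (h : s ≤ n) : lazardCoeff n (n - s) = lazardCoeff n s := by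
  unfold lazardCoeff
  rw [Nat.choose_symm h]

/-- The coefficients of `C_n` satisfy the cocycle relations `C(s,i) b_{n,s} = C(n-i,s-i) b_{n,i}` (`1 ≤ i ≤ s ≤ n-1`), i.e.
`C_n` is a 2-cocycle — from `C(n,s) C(s,i) = C(n,i) C(n-i,s-i)`. [cite: Lazard1955, §III (3.6)] -/
theorem choose_mul_lazardCoeff {n i s : ℕ} (hi : 1 ≤ i) (his : i ≤ s) (hs : s ≤ n - 1) :
    s.choose i * lazardCoeff n s = (n - i).choose (s - i) * lazardCoeff n i := by
  have hd : cocycleGcd n ≠ 0 := cocycleGcd_ne_zero (by omega)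
  apply Nat.eq_of_mul_eq_mul_right (Nat.pos_of_ne_zero hd)
  rw [mul_assoc, lazardCoeff_mul_cocycleGcd (le_trans hi his) hs, mul_assoc,
    lazardCoeff_mul_cocycleGcd hi (le_trans his hs), mul_comm, Nat.choose_mul his, mul_comm]

/-! ## §2 Lucas' theorem in block form, and the index `s₀` -/

section Lucas

variable {p : ℕ} [hp : Fact p.Prime]

/-- **Lucas in block form**: for `B, D < p^a`, `C(p^a A + B, p^a C + D) ≡ C(A,C) · C(B,D) (mod p)` (Lucas' congruence on
base-`p` digits, grouped into the `a` low digits and the rest). [cite: Fine1947, Theorem 1] -/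
theorem choose_modEq_block (a A B C D : ℕ) (hB : B < p ^ a) (hD : D < p ^ a) :
    (p ^ a * A + B).choose (p ^ a * C + D) ≡ A.choose C * B.choose D [MOD p] := by
  have hpa : 0 < p ^ a := pow_pos hp.out.pos a
  have h1 := (Choose.choose_modEq_choose_mul_prod_range_choose (n := p ^ a * A + B) (k := p ^ a * C + D) (p := p) a)
  have h2 := (Choose.choose_modEq_choose_mul_prod_range_choose (n := B) (k := D) (p := p) a)
  rw [← Int.natCast_modEq_iff]
  have hdA : (p ^ a * A + B) / p ^ a = A := by
    rw [Nat.add_comm, Nat.add_mul_div_left _ _ hpa, Nat.div_eq_of_lt hB, zero_add]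
  have hdC : (p ^ a * C + D) / p ^ a = C := by
    rw [Nat.add_comm, Nat.add_mul_div_left _ _ hpa, Nat.div_eq_of_lt hD, zero_add]
  have hdig : ∀ i ∈ Finset.range a, ((p ^ a * A + B) / p ^ i % p).choose ((p ^ a * C + D) / p ^ i % p) =
      (B / p ^ i % p).choose (D / p ^ i % p) := by
    intro i hi
    rw [Finset.mem_range] at hi
    have hpi : 0 < p ^ i := pow_pos hp.out.pos i
    obtain ⟨c, hc⟩ : ∃ c, a = i + (c + 1) := ⟨a - i - 1, by omega⟩
    have key : ∀ E F : ℕ, (p ^ a * E + F) / p ^ i % p = F / p ^ i % p := by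
      intro E F
      rw [hc, pow_add, mul_assoc, Nat.add_comm, Nat.add_mul_div_left _ _ hpi, pow_succ]
      have : p ^ c * p * E = p * (p ^ c * E) := by ring
      rw [this, Nat.add_mul_mod_self_left]
    rw [key, key]
  rw [Finset.prod_congr rfl hdig, hdA, hdC] at h1
  rw [Nat.div_eq_of_lt hB, Nat.div_eq_of_lt hD, Nat.choose_zero_right, Nat.cast_one, one_mul] at h2
  push_cast at h1 h2 ⊢
  exact h1.trans ((Int.ModEq.refl _).mul h2.symm)

/-- `C ≡ r (mod p)` with `p ∤ r` gives `gcd(C, p) = 1`. [folklore] -/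
private theorem coprime_of_modEq_of_not_dvd {C r : ℕ} (h : C ≡ r [MOD p]) (hr : ¬ p ∣ r) : Nat.Coprime C p :=
  Nat.Coprime.symm ((Nat.Prime.coprime_iff_not_dvd hp.out).mpr fun hC =>
    hr ((Nat.ModEq.dvd_iff h (dvd_refl p)).mp hC))

/-- If the `j`-th base-`p` digit of `s` is nonzero then `p ∤ C(s, p^j)` — Lucas: `C(s, p^j) ≡ ⌊s/p^j⌋ (mod p)`.
[cite: Fine1947, Theorem 1] -/
theorem coprime_choose_prime_pow_of_digit_ne_zero {s j : ℕ} (hdig : s / p ^ j % p ≠ 0) :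
    Nat.Coprime (s.choose (p ^ j)) p := by
  have hpj : 0 < p ^ j := pow_pos hp.out.pos j
  have h := choose_modEq_block (p := p) j (s / p ^ j) (s % p ^ j) 1 0 (Nat.mod_lt _ hpj) hpj
  rw [Nat.div_add_mod, mul_one, add_zero, Nat.choose_one_right, Nat.choose_zero_right, mul_one] at h
  exact coprime_of_modEq_of_not_dvd h fun hd => hdig (Nat.mod_eq_zero_of_dvd hd)

/-- `p ∤ C(p^a A + (p^a - 1), p^a - 1)` — Lucas: this binomial coefficient is `≡ C(A,0)·C(p^a-1,p^a-1) = 1 (mod p)`.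
[cite: Fine1947, Theorem 1] -/
theorem coprime_choose_block_pred (a A : ℕ) : Nat.Coprime ((p ^ a * A + (p ^ a - 1)).choose (p ^ a - 1)) p := by
  have hpa : 0 < p ^ a := pow_pos hp.out.pos a
  have h := choose_modEq_block (p := p) a A (p ^ a - 1) 0 (p ^ a - 1) (Nat.sub_lt hpa one_pos) (Nat.sub_lt hpa one_pos)
  rw [mul_zero, zero_add, Nat.choose_zero_right, Nat.choose_self, mul_one] at h
  exact coprime_of_modEq_of_not_dvd h hp.out.not_dvd_one

end Lucas

section Index

variable (p : ℕ) [hp : Fact p.Prime]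

/-- Lazard's index `s₀`: `n / p` if `n` is a power of `p`, else `p^{v_p(n)}` — the index at which the coefficient of `C_n` is
prime to `p` and which controls all other coefficients of a symmetric cocycle (Lazard 1955, §III, cases 1°–2°).
[cite: Lazard1955, §III] -/
def lazardIndex (n : ℕ) : ℕ :=
  if n = p ^ n.factorization p then p ^ (n.factorization p - 1) else p ^ n.factorization p

variable {p}

omit hp in
/-- For `n ≥ 2` a power of `p`, the exponent `v_p(n)` is positive. [cite: Lazard1955, §III] -/
theorem factorization_pos_of_eq_pow {n : ℕ} (hn : 2 ≤ n) (h : n = p ^ n.factorization p) : 1 ≤ n.factorization p := by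
  by_contra h0
  rw [not_le, Nat.lt_one_iff] at h0
  rw [h0, pow_zero] at h
  omega

/-- `1 ≤ s₀`. [cite: Lazard1955, §III] -/
theorem one_le_lazardIndex (n : ℕ) : 1 ≤ lazardIndex p n := by
  unfold lazardIndex
  split_ifs <;> exact Nat.one_le_pow _ _ hp.out.pos

/-- `s₀ ≤ n - 1` for `n ≥ 2`. [cite: Lazard1955, §III] -/
theorem lazardIndex_le {n : ℕ} (hn : 2 ≤ n) : lazardIndex p n ≤ n - 1 := by
  unfold lazardIndex
  split_ifs with h
  · have he := factorization_pos_of_eq_pow hn h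
    have : p ^ (n.factorization p - 1) < p ^ n.factorization p := Nat.pow_lt_pow_right hp.out.one_lt (by omega)
    omega
  · have hdvd : p ^ n.factorization p ∣ n := Nat.ordProj_dvd n p
    have hle : p ^ n.factorization p ≤ n := Nat.le_of_dvd (by omega) hdvd
    omega

/-- `p ∤ C(n, p^{v_p(n)})` for `n ≥ 1` (Lucas: `C(p^e m, p^e) ≡ m (mod p)`, `p ∤ m`). [cite: Lazard1955, §III (3.1)] -/
theorem not_dvd_choose_ordProj {n : ℕ} (hn : n ≠ 0) :
    ¬ p ∣ n.choose (p ^ n.factorization p) := by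
  set e := n.factorization p with he
  have hsplit : p ^ e * (n / p ^ e) = n := Nat.ordProj_mul_ordCompl_eq_self n p
  have hcop : Nat.Coprime p (n / p ^ e) := Nat.coprime_ordCompl hp.out hn
  have hmod : n.choose (p ^ e) ≡ (n / p ^ e).choose 1 [MOD p] := by
    have h1 := Choose.choose_pow_mul_pow_mul_modEq_choose_nat (p := p) (k := e) (a := n / p ^ e) (b := 1)
    rwa [hsplit, mul_one] at h1
  rw [Nat.choose_one_right] at hmod
  intro hdvd
  have : p ∣ n / p ^ e := (Nat.ModEq.dvd_iff hmod (dvd_refl p)).mp hdvd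
  exact (Nat.Prime.coprime_iff_not_dvd hp.out).mp hcop this

/-- **`p ∤ b_{n,s₀}`**: the coefficient of `C_n` at Lazard's index is prime to `p` (`n ≥ 2`).  For `n = p^e`:
`v_p C(p^e, p^{e-1}) = 1` (Kummer) and `d_n = p`; otherwise `p ∤ C(n, p^{v_p n})`. [cite: Lazard1955, §III (3.1)–(3.3)] -/
theorem not_dvd_lazardCoeff_lazardIndex {n : ℕ} (hn : 2 ≤ n) : ¬ p ∣ lazardCoeff n (lazardIndex p n) := by
  unfold lazardIndex
  split_ifs with h
  · -- `n = p^e`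
    set e := n.factorization p with he
    have he1 : 1 ≤ e := factorization_pos_of_eq_pow hn h
    have hprimepow : IsPrimePow n := by
      rw [h]; exact (hp.out.prime.isPrimePow).pow (by omega)
    have hd : cocycleGcd n = p := by
      unfold cocycleGcd
      rw [Choose.gcd_choose_eq_minFac_of_isPrimePow hprimepow, h, Nat.pow_minFac (by omega), hp.out.minFac_eq]
    have hk : p ^ (e - 1) ≤ p ^ e := Nat.pow_le_pow_right hp.out.pos (by omega)
    have hk0 : p ^ (e - 1) ≠ 0 := (pow_pos hp.out.pos _).ne'
    have hfac : (n.choose (p ^ (e - 1))).factorization p = 1 := by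
      rw [h, Nat.factorization_choose_prime_pow hp.out hk hk0, hp.out.factorization_pow]
      simp only [Finsupp.single_eq_same]
      omega
    have hC0 : n.choose (p ^ (e - 1)) ≠ 0 := (Nat.choose_pos (by rw [h]; exact hk)).ne'
    have hcop : Nat.Coprime p (n.choose (p ^ (e - 1)) / p ^ (n.choose (p ^ (e - 1))).factorization p) :=
      Nat.coprime_ordCompl hp.out hC0
    rw [hfac, pow_one] at hcop
    unfold lazardCoeff
    rw [hd]
    exact (Nat.Prime.coprime_iff_not_dvd hp.out).mp hcop
  · -- `n` not a power of `p`
    intro hdvd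
    apply not_dvd_choose_ordProj (p := p) (n := n) (by omega)
    have hs1 : 1 ≤ p ^ n.factorization p := Nat.one_le_pow _ _ hp.out.pos
    have hs2 : p ^ n.factorization p ≤ n - 1 := by
      have := lazardIndex_le (p := p) hn
      unfold lazardIndex at this
      rwa [if_neg h] at this
    rw [← lazardCoeff_mul_cocycleGcd hs1 hs2]
    exact Dvd.dvd.mul_right hdvd _

/-- If `n ≥ 2` is not a power of `p` then `d_n` is prime to `p` (it divides `C(n, p^{v_p n})`). [cite: Lazard1955, §III (3.1)] -/
theorem coprime_cocycleGcd {n : ℕ} (hn : 2 ≤ n) (h : n ≠ p ^ n.factorization p) : Nat.Coprime (cocycleGcd n) p := by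
  have hs1 : 1 ≤ p ^ n.factorization p := Nat.one_le_pow _ _ hp.out.pos
  have hs2 : p ^ n.factorization p ≤ n - 1 := by
    have := lazardIndex_le (p := p) hn
    unfold lazardIndex at this
    rwa [if_neg h] at this
  have hd := cocycleGcd_dvd_choose hs1 hs2
  refine Nat.Coprime.symm ((Nat.Prime.coprime_iff_not_dvd hp.out).mpr fun hpd => ?_)
  exact not_dvd_choose_ordProj (p := p) (by omega) (hpd.trans hd)

end Index

end Literature.RingTheory.FormalGroups
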